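import Mathlib
import Summits.Ventures.HodgeRepro.Tier4.Line1.RTFSetting
import Summits.Ventures.HodgeRepro.Tier4.Line4.L1ClassV3
import Summits.Ventures.HodgeRepro.Tier4.Line4.ArchDistBounds

/-!
# Tier4/Line4/OrbitDist — the archimedean size of a rational double coset

Blind re-derivation cell `pub-hodge-repro`, Tier 4 «PROVE THE STEP», LINE L4 (C-L4-TAIL; plan-4 g4's (T) ruling STATUS
S14998: no orbit invariant, the size of an orbit is the `archDist` of its elements, constant up to a constant on an orbit),
seat t4-L3-p2 (g3), statement-first.

* `orbitDist S o := sInf {archDist W γ : γ rational, orbitOf γ = o}` — the range is non-empty (every orbit is the class of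
  some `γ`) and bounded below by `0` (`archDist_nonneg`), so this is a genuine infimum: no choice, no well-definedness lemma.
* `orbitDist_nonneg`, `orbitDist_le (h : orbitOf γ = o) : orbitDist S o ≤ archDist W γ` (`csInf_le`).
* `archDist_le_orbitDist_add`: if `archDist` is bounded on `T(k)` and on `T′(k)` (the tori compact at infinity — the
  display's form of that compactness), then `archDist γ ≤ orbitDist S o + c` for every `γ` in the orbit `o`: two elements of
  one orbit differ by `τ · γ · τ′` (`DoubleCoset.eq`) and `archDist` is subadditive (`archDist_mul_le`, ArchDistBounds), so
  every element of the orbit is within `2 c` of every other, and the infimum is within `2 c` of each of them (`le_csInf`).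

Nothing here says anything about the status of the Hodge conjecture for CM abelian varieties, which is NOT proved
(HC_CM is NOT proved by anyone in this repository).
-/

set_option autoImplicit false

noncomputable section

namespace Summit.Ventures.HodgeRepro.Tier4.Line4

open Summit.Ventures.HodgeRepro.Tier4.Common NumberField
open Summit.Ventures.HodgeRepro.Tier4.Line1.RTF
open Summit.Ventures.HodgeRepro.Tier4.Line4.L1Class (archDist archDist_nonneg archDist_mul_le)

variable {k : Type} [Field k] [NumberField k] (W : PlaneData k) [MeasurableSpace (GA W)]
  (S : Setting (GA W))

/-- **THE ARCHIMEDEAN SIZE OF AN ORBIT**: the infimum of `archDist` over the rational elements of the double coset. -/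
def orbitDist (o : S.Orbit) : ℝ :=
  sInf (Set.range fun γ : {γ : S.Gk // S.orbitOf γ = o} => archDist W (γ.1 : GA W))

/-- Every orbit is the class of some rational element. -/
theorem exists_orbitOf_eq (o : S.Orbit) : ∃ γ : S.Gk, S.orbitOf γ = o :=
  ⟨o.out, DoubleCoset.out_eq' _ _ o⟩

/-- The range defining `orbitDist` is non-empty. -/
theorem orbitDist_range_nonempty (o : S.Orbit) :
    (Set.range fun γ : {γ : S.Gk // S.orbitOf γ = o} => archDist W (γ.1 : GA W)).Nonempty := by
  obtain ⟨γ, hγ⟩ := exists_orbitOf_eq W S o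
  exact ⟨_, ⟨⟨γ, hγ⟩, rfl⟩⟩

/-- `0` is a lower bound of the range defining `orbitDist`. -/
theorem orbitDist_range_bddBelow (o : S.Orbit) :
    BddBelow (Set.range fun γ : {γ : S.Gk // S.orbitOf γ = o} => archDist W (γ.1 : GA W)) :=
  ⟨0, by rintro _ ⟨γ, rfl⟩; exact archDist_nonneg W _⟩

/-- `orbitDist` is non-negative. -/
theorem orbitDist_nonneg (o : S.Orbit) : 0 ≤ orbitDist W S o :=
  le_csInf (orbitDist_range_nonempty W S o) (by rintro _ ⟨γ, rfl⟩; exact archDist_nonneg W _)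

/-- `orbitDist` is below the `archDist` of every element of the orbit. -/
theorem orbitDist_le {o : S.Orbit} (γ : S.Gk) (h : S.orbitOf γ = o) : orbitDist W S o ≤ archDist W (γ : GA W) :=
  csInf_le (orbitDist_range_bddBelow W S o) ⟨⟨γ, h⟩, rfl⟩

/-- **THE ORBIT SIZE IS CONSTANT UP TO A CONSTANT**: if `archDist` is bounded on `T(k)` and on `T′(k)` then every element
of an orbit is within `2 c` of the orbit size. -/
theorem archDist_le_orbitDist_add {cT cT' : ℝ}
    (hT : ∀ τ : S.Gk, τ ∈ S.Tk → archDist W (τ : GA W) ≤ cT)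
    (hT' : ∀ τ' : S.Gk, τ' ∈ S.T'k → archDist W (τ' : GA W) ≤ cT') :
    ∀ (o : S.Orbit) (γ : S.Gk), S.orbitOf γ = o → archDist W (γ : GA W) ≤ orbitDist W S o + (cT + cT') := by
  intro o γ hγ
  rw [← sub_le_iff_le_add]
  refine le_csInf (orbitDist_range_nonempty W S o) ?_
  rintro _ ⟨⟨γ', hγ'⟩, rfl⟩
  -- `γ' = τ γ τ'` with `τ ∈ T(k)`, `τ' ∈ T'(k)`
  have heq : S.orbitOf γ = S.orbitOf γ' := hγ.trans hγ'.symm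
  obtain ⟨τ, hτ, τ', hτ', hγγ'⟩ := (DoubleCoset.eq S.Tk S.T'k γ γ').1 heq
  -- `γ = τ⁻¹ γ' τ'⁻¹`
  have hback : (γ : GA W) = (τ⁻¹ : S.Gk) * (γ' : GA W) * (τ'⁻¹ : S.Gk) := by
    rw [hγγ']
    push_cast
    group
  have h1 := archDist_mul_le W ((τ⁻¹ : S.Gk) * (γ' : GA W)) ((τ'⁻¹ : S.Gk) : GA W)
  have h2 := archDist_mul_le W ((τ⁻¹ : S.Gk) : GA W) (γ' : GA W)
  have h3 := hT τ⁻¹ (S.Tk.inv_mem hτ)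
  have h4 := hT' τ'⁻¹ (S.T'k.inv_mem hτ')
  rw [hback]
  linarith

end Summit.Ventures.HodgeRepro.Tier4.Line4

end
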